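import Summits.QuantumFields.QCD.Theses.QuarksAsStableAction

/-!
# Chiral-window bookkeeping for the bare-mass trajectories of a `QCDRegularisation`
(crux `QuarksAsStableAction.StableActionBridge`, item stmt-QuantumFields-9737, line `Sketch`;
registered stubs `eventually_abs_mq_le` and `tendsto_a_div_Zm` of the lead skeleton)

The route's stability hypothesis (`WilsonQuarkStability`) is typed for bare Wilson masses in a
window `|m| ≤ ε` around the free critical point; the summit statement's lattice theories run along
the bare trajectories `m_f(k) = m_crit(k) + a_k m_f / Z_m(k)` of a `QCDRegularisation`
(`QCDRegularisation.scheme_mq`).  These two lemmas are the bookkeeping that the statement's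
trajectories ENTER that window eventually.

* `eventually_abs_mq_le` — if `m_crit(k) → 0` and `a_k / Z_m(k) → 0`, then for every fixed mass
  tuple `m` and every `ε > 0`, eventually `|m_f(k)| ≤ ε` for all (finitely many) flavours `f`.
* `tendsto_a_div_Zm` — under leading-log mass scaling (`HasMassScaling`) with a positive exponent
  `γ₀/(2β₀)`, `Z_m(k) → +∞` (since `log a_k⁻² → +∞`), hence `a_k / Z_m(k) → 0`.

Pure filter / real-analysis bookkeeping over the tree's definitions (`QCDOS.lean`).
-/

open Filter Literature.MathematicalPhysics.QuantumFieldTheory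
open scoped Topology

namespace Summit.QuantumFields.QCD.Cruxes.StableActionBridge.Sketch

/-- **The bare trajectories enter every chiral window.** If the critical bare mass `m_crit(k) → 0`
and `a_k / Z_m(k) → 0`, then for every fixed tuple of renormalised masses `m` and every `ε > 0`,
eventually in `k` all bare Wilson masses `m_f(k) = m_crit(k) + a_k m_f / Z_m(k)` of the realising
scheme satisfy `|m_f(k)| ≤ ε` (finitely many flavours: `Filter.eventually_all`). [folklore] -/
theorem eventually_abs_mq_le : ∀ (Nf : ℕ) (reg : QCDRegularisation Nf) (m : Fin Nf → ℝ) (z shift : QCDField Nf → ℕ → ℝ) (ε : ℝ), 0 < ε → Tendsto reg.mcrit atTop (𝓝 0) → Tendsto (fun k => reg.a k / reg.Zm k) atTop (𝓝 0) → ∀ᶠ k in atTop, ∀ f, |(reg.scheme m z shift).mq f k| ≤ ε := by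
  intro Nf reg m z shift ε hε hcrit haZ
  refine eventually_all.2 fun f => ?_
  -- per flavour: `m_crit(k) + (a_k / Z_m(k)) m_f → 0 + 0 · m_f = 0`
  have h0 : Tendsto (fun k => reg.mcrit k + reg.a k / reg.Zm k * m f) atTop (𝓝 0) := by
    simpa using hcrit.add (haZ.mul_const (m f))
  have hmq : Tendsto (fun k => (reg.scheme m z shift).mq f k) atTop (𝓝 0) := by
    refine h0.congr fun k => ?_
    rw [QCDRegularisation.scheme_mq]
    ring
  filter_upwards [Metric.tendsto_nhds.1 hmq ε hε] with k hk
  rw [Real.dist_0_eq_abs] at hk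
  exact hk.le

/-- **Leading-log mass scaling forces `a_k / Z_m(k) → 0`.** Under `HasMassScaling`
(`Z_m(k) / (log a_k⁻²)^p → c > 0`) with a positive exponent `p = γ₀/(2β₀)`: `a_k → 0⁺` gives
`a_k⁻² → +∞`, `log a_k⁻² → +∞`, `(log a_k⁻²)^p → +∞`, so `Z_m(k) = (Z_m(k)/(log a_k⁻²)^p) · (log a_k⁻²)^p
→ +∞` (eventually, where the power is positive), and finally `a_k / Z_m(k) → 0`. [folklore] -/
theorem tendsto_a_div_Zm : ∀ (Nf : ℕ) (reg : QCDRegularisation Nf), reg.HasMassScaling → 0 < massExponent Nf → Tendsto (fun k => reg.a k / reg.Zm k) atTop (𝓝 0) := by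
  intro Nf reg hms hp
  obtain ⟨c, hc, hZ⟩ := hms
  -- `a_k² → 0⁺`
  have ha2 : Tendsto (fun k => reg.a k ^ 2) atTop (𝓝[>] 0) := by
    refine tendsto_nhdsWithin_iff.2 ⟨?_, Eventually.of_forall fun k => ?_⟩
    · simpa using reg.tendsto_a.pow 2
    · exact pow_pos (reg.a_pos k) 2
  -- `1 / a_k² → +∞`
  have hinv : Tendsto (fun k => 1 / reg.a k ^ 2) atTop atTop := by
    refine ha2.inv_tendsto_nhdsGT_zero.congr fun k => ?_
    simp [one_div]
  -- `ℓ_k := log (1 / a_k²) → +∞` and `ℓ_k ^ p → +∞`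
  have hlog : Tendsto (fun k => Real.log (1 / reg.a k ^ 2)) atTop atTop :=
    Real.tendsto_log_atTop.comp hinv
  have hpow : Tendsto (fun k => Real.log (1 / reg.a k ^ 2) ^ massExponent Nf) atTop atTop :=
    (tendsto_rpow_atTop hp).comp hlog
  -- `Z_m(k) = (Z_m(k) / ℓ_k ^ p) * ℓ_k ^ p` eventually, so `Z_m → +∞`
  have hZm : Tendsto reg.Zm atTop atTop := by
    refine (Filter.Tendsto.pos_mul_atTop hc hZ hpow).congr' ?_
    filter_upwards [hlog.eventually_gt_atTop 0] with k hk
    have hne : Real.log (1 / reg.a k ^ 2) ^ massExponent Nf ≠ 0 :=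
      (Real.rpow_pos_of_pos hk _).ne'
    exact div_mul_cancel₀ (reg.Zm k) hne
  -- `a_k / Z_m(k) → 0`
  exact reg.tendsto_a.div_atTop hZm

end Summit.QuantumFields.QCD.Cruxes.StableActionBridge.Sketch
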